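import Summits.QuantumFields.BalabanUV.T4Continuum.Support.ShellMeasureAverageAnalytic

/-!
# `T4Continuum.ShellMeasureAverageAnalyticLoc` — the LOCAL engine: unit-valued maps ANALYTIC ON A BALL with two-sided
# bounds and a Lipschitz-at-`0` constant (`BallWord`), closed under products ∕ inverses ∕ `pathProd`, under restriction of
# the entire words of file 1 (`ExpWord`), and — the point — under ONE AVERAGING STEP `B ↦ expU (Σ_x a_x • mlog (W_x B)) · T B`;
# the RELATIVE CHART `B ↦ (−i)·log(G(B)·G(0)⁻¹)` of a local word is analytic ∕ `0` at `0` ∕ linearly bounded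
(cell `pub-balaban`, sub-cell `t4`, spine estimate NE7c (node U5b), owner lineage `b2b-balaban-t4-ne7c-p1` gen 28, table
`LEAVES-NE7c-P1.md` row S58 (engine for rows S55 — the moving frames of [Balaban1985Averaging] (89) — and S57 — the
k-fold iterate); imports file 1 `ShellMeasureAverageAnalytic` ONLY; [folklore]; 0 sorry)

HONEST FRAMING.  Finite four-torus programme, rung (B)+1 only — NOT infinite volume, NOT a mass gap, NOT the Clay
problem, NOT summit progress; (B), `BetaPertHyp`, (B^μ) are not consumed.  NE7c (`T4IndicatorShell.ShellWeightBound`)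
is NOT PRINTED and NOT PROVED; «NE7c ⇐ the named binders» (WALL `t4/b2b-balaban-t4-ne7c-p1/WALL-NE7c-P1.md`).
ELEMENTARY COMPLEX ANALYSIS in a complete normed algebra ([folklore]); nothing printed is asserted or cited; the one
`structure … : Prop` bundles elementary facts about a unit-valued map and names no wall binder.  HONEST DEPENDENCY
(cell): continuum YM on T⁴ ⇐ BetaPertH ∧ nine spine estimates (0/9 proved); BetaPertH ⇐ (D1) ∧ (D4) ∧ CAP+tail; G-an2-4
gates asym, D1 and NE2/3/4.

WHY.  File 1's `ExpWord`s are ENTIRE; one averaging step `B ↦ e^{Σ a_x log W_x(B)}·T(B)` leaves that class (the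
logarithm lives on a ball) but stays unit-valued, analytic ON A BALL, two-sidedly bounded, Lipschitz at `0` — and THAT
list IS preserved by the averaging step (§4), so averages can be ITERATED ([Balaban1985Averaging] (90)–(91), Prop. 4
(127): «a composition of the functions Q(U₀,·), Q(Ū₀,·), …») and the MOVING FRAMES of (89) can enter the next word as
factors.  Nothing of those propositions is proved HERE — this is the bookkeeping class rows S55∕S56∕S57 use.
* §1 `BallWord f r K κ`: `0 < r`, `1 ≤ K`, `0 ≤ κ`; on `‖B‖ < r`: value and inverse value analytic, `‖f B‖, ‖(f B)⁻¹‖ ≤ K`,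
  `‖f B − f 0‖ ≤ κ‖B‖`.  Closure: `const`, `mono`, `shrink`, `mul` (`K₁K₂`, `κ₁K₂ + K₁κ₂`), `inv` (`K`, `K²κ`), `pathProd`
  (`Kⁿ`, `n·Kⁿ·κ`), and `ofExpWord` (file 1's entire words restricted to `ball 0 r`: `K = e^{wr}`, `κ = (e^{wr}+1)∕r`).
* §2–§3 `‖f 0 − 1‖ ≤ ε`, `ε + κr′ ≤ 1∕2`, `r′ ≤ r` ⟹ on `‖B‖ < r′`: `‖f B − 1‖ ≤ 1∕2`, `mlog ∘ f` analytic, `‖mlog (f B)‖ ≤ 1`;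
  the exponent `S(B) = Σ_{x∈s} a_x • mlog (W_x B)` (`Σ‖a_x‖ ≤ 1`) is analytic with `‖S B‖ ≤ 1`.
* §4 **THE AVERAGING STEP** `averagingStep_ballWord`: `G(B) := expU (S B) * T B` is a `BallWord` on `r′` with
  `K_G = 3K_T`, `κ_G = 6K_T∕r′` (`‖e^{±S}‖ ≤ e ≤ 3`; Lipschitz by file 1's Schwarz-at-0).
* §5 **THE RELATIVE CHART OF A LOCAL WORD** (the shape of `B12AverageCorridor267.Qtilde` and of every level's chart map):
  for a `BallWord G r K κ`, `Z(B) := G(B)·G(0)⁻¹` has `Z 0 = 1`, is analytic, `‖Z B − 1‖ ≤ κK‖B‖` (NO Schwarz: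
  `Z B − 1 = (G B − G 0)·G(0)⁻¹`); on `‖B‖ < r″ ≤ r` with `κKr″ ≤ 1∕2`:
  **`relChart_analyticOnNhd`** (`B ↦ (−I)•mlog (Z B)` is `AnalyticOnNhd ℂ` on `ball 0 r″`), **`relChart_zero`**,
  **`norm_relChart_le`** (`≤ 2κK‖B‖ ≤ 1`).
-/

noncomputable section

open NormedSpace Metric Set

namespace Summit.QuantumFields.BalabanUV.T4Continuum.ShellMeasureAverageAnalyticLoc

open Literature.MathematicalPhysics.QuantumFieldTheory.Balaban1983to89
open B12AverageCorridor267 (expU val_expU val_inv_expU)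
open B7Eq61Linearization (pathProd pathProd_zero pathProd_succ)
open MatrixLog (mlog norm_mlog_le_two_mul mlog_one)
open ShellMeasureAverageAnalytic (ExpWord norm_exp_le' norm_sub_apply_zero_le)

variable {E : Type*} [NormedAddCommGroup E] [NormedSpace ℂ E]
variable {𝔸 : Type*} [NormedRing 𝔸] [NormedAlgebra ℂ 𝔸]

/-! ## §1 Local words -/

/-- A UNIT-VALUED MAP ANALYTIC ON THE BALL `‖B‖ < r` WITH TWO-SIDED BOUNDS `K` AND A LIPSCHITZ-AT-`0` CONSTANT `κ`:
value and inverse value analytic at every point of the ball, `‖f B‖, ‖(f B)⁻¹‖ ≤ K`, `‖f B − f 0‖ ≤ κ‖B‖`.  (The shape of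
a block average, of a moving frame, and of every finite product of such, as functions of the chart variable.) [folklore] -/
@[folklore]
structure BallWord (f : E → 𝔸ˣ) (r K κ : ℝ) : Prop where
  /-- the radius is positive -/
  r_pos : 0 < r
  /-- the two-sided bound is at least `1` -/
  one_le : 1 ≤ K
  /-- the Lipschitz-at-`0` constant is nonnegative -/
  nonneg : 0 ≤ κ
  /-- the value is analytic on the ball -/
  an : ∀ B : E, ‖B‖ < r → AnalyticAt ℂ (fun B => ((f B : 𝔸ˣ) : 𝔸)) B
  /-- the inverse value is analytic on the ball -/
  an_inv : ∀ B : E, ‖B‖ < r → AnalyticAt ℂ (fun B => (((f B)⁻¹ : 𝔸ˣ) : 𝔸)) B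
  /-- bound on the value -/
  le : ∀ B : E, ‖B‖ < r → ‖((f B : 𝔸ˣ) : 𝔸)‖ ≤ K
  /-- bound on the inverse value -/
  le_inv : ∀ B : E, ‖B‖ < r → ‖(((f B)⁻¹ : 𝔸ˣ) : 𝔸)‖ ≤ K
  /-- Lipschitz at `0` -/
  lip : ∀ B : E, ‖B‖ < r → ‖((f B : 𝔸ˣ) : 𝔸) - ((f 0 : 𝔸ˣ) : 𝔸)‖ ≤ κ * ‖B‖

namespace BallWord

variable {f g : E → 𝔸ˣ} {r r' K K₁ K₂ K' κ κ₁ κ₂ κ' : ℝ}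

/-- The value at `0` is bounded by `K`. [folklore] -/
theorem le_zero (hf : BallWord f r K κ) : ‖((f 0 : 𝔸ˣ) : 𝔸)‖ ≤ K := hf.le 0 (by rw [norm_zero]; exact hf.r_pos)

/-- The inverse value at `0` is bounded by `K`. [folklore] -/
theorem le_inv_zero (hf : BallWord f r K κ) : ‖(((f 0)⁻¹ : 𝔸ˣ) : 𝔸)‖ ≤ K :=
  hf.le_inv 0 (by rw [norm_zero]; exact hf.r_pos)

/-- A constant unit with `‖v‖, ‖v⁻¹‖ ≤ K`, `1 ≤ K`: a local word with `κ = 0` on any ball. [folklore] -/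
theorem const (hr : 0 < r) (hK : 1 ≤ K) {v : 𝔸ˣ} (h1 : ‖(v : 𝔸)‖ ≤ K) (h2 : ‖((v⁻¹ : 𝔸ˣ) : 𝔸)‖ ≤ K) :
    BallWord (fun _ : E => v) r K 0 where
  r_pos := hr
  one_le := hK
  nonneg := le_rfl
  an _ _ := analyticAt_const
  an_inv _ _ := analyticAt_const
  le _ _ := h1
  le_inv _ _ := h2
  lip B _ := by rw [sub_self, norm_zero, zero_mul]

/-- Weakening the constants. [folklore] -/
theorem mono (hf : BallWord f r K κ) (hK : K ≤ K') (hκ : κ ≤ κ') : BallWord f r K' κ' where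
  r_pos := hf.r_pos
  one_le := hf.one_le.trans hK
  nonneg := hf.nonneg.trans hκ
  an := hf.an
  an_inv := hf.an_inv
  le B hB := (hf.le B hB).trans hK
  le_inv B hB := (hf.le_inv B hB).trans hK
  lip B hB := (hf.lip B hB).trans (mul_le_mul_of_nonneg_right hκ (norm_nonneg B))

/-- Shrinking the ball. [folklore] -/
theorem shrink (hf : BallWord f r K κ) (hr' : 0 < r') (hle : r' ≤ r) : BallWord f r' K κ where
  r_pos := hr'
  one_le := hf.one_le
  nonneg := hf.nonneg
  an B hB := hf.an B (hB.trans_le hle)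
  an_inv B hB := hf.an_inv B (hB.trans_le hle)
  le B hB := hf.le B (hB.trans_le hle)
  le_inv B hB := hf.le_inv B (hB.trans_le hle)
  lip B hB := hf.lip B (hB.trans_le hle)

/-- Inverses: same bounds, Lipschitz constant `K²κ` (`f(B)⁻¹ − f(0)⁻¹ = f(B)⁻¹·(f(0) − f(B))·f(0)⁻¹`). [folklore] -/
theorem inv (hf : BallWord f r K κ) : BallWord (fun B => (f B)⁻¹) r K (K ^ 2 * κ) where
  r_pos := hf.r_pos
  one_le := hf.one_le
  nonneg := mul_nonneg (pow_nonneg (zero_le_one.trans hf.one_le) 2) hf.nonneg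
  an := hf.an_inv
  an_inv B hB := by simp only [inv_inv]; exact hf.an B hB
  le := hf.le_inv
  le_inv B hB := by simp only [inv_inv]; exact hf.le B hB
  lip B hB := by
    have hK0 : 0 ≤ K := zero_le_one.trans hf.one_le
    have key : (((f B)⁻¹ : 𝔸ˣ) : 𝔸) * (((f 0 : 𝔸ˣ) : 𝔸) - ((f B : 𝔸ˣ) : 𝔸)) * (((f 0)⁻¹ : 𝔸ˣ) : 𝔸)
        = (((f B)⁻¹ : 𝔸ˣ) : 𝔸) - (((f 0)⁻¹ : 𝔸ˣ) : 𝔸) := by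
      rw [mul_sub, sub_mul, mul_assoc (((f B)⁻¹ : 𝔸ˣ) : 𝔸) ((f 0 : 𝔸ˣ) : 𝔸), Units.mul_inv, mul_one,
        Units.inv_mul, one_mul]
    rw [← key]
    calc ‖(((f B)⁻¹ : 𝔸ˣ) : 𝔸) * (((f 0 : 𝔸ˣ) : 𝔸) - ((f B : 𝔸ˣ) : 𝔸)) * (((f 0)⁻¹ : 𝔸ˣ) : 𝔸)‖
        ≤ ‖(((f B)⁻¹ : 𝔸ˣ) : 𝔸)‖ * ‖((f 0 : 𝔸ˣ) : 𝔸) - ((f B : 𝔸ˣ) : 𝔸)‖ * ‖(((f 0)⁻¹ : 𝔸ˣ) : 𝔸)‖ :=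
          (norm_mul_le _ _).trans (mul_le_mul_of_nonneg_right (norm_mul_le _ _) (norm_nonneg _))
      _ ≤ K * (κ * ‖B‖) * K := by
          refine mul_le_mul (mul_le_mul (hf.le_inv B hB) ?_ (norm_nonneg _) hK0) hf.le_inv_zero (norm_nonneg _)
            (mul_nonneg hK0 (mul_nonneg hf.nonneg (norm_nonneg _)))
          rw [norm_sub_rev]; exact hf.lip B hB
      _ = K ^ 2 * κ * ‖B‖ := by ring

/-- Products: `K₁K₂`, Lipschitz `κ₁K₂ + K₁κ₂` (`fg − f₀g₀ = (f − f₀)g + f₀(g − g₀)`). [folklore] -/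
theorem mul (hf : BallWord f r K₁ κ₁) (hg : BallWord g r K₂ κ₂) :
    BallWord (fun B => f B * g B) r (K₁ * K₂) (κ₁ * K₂ + K₁ * κ₂) where
  r_pos := hf.r_pos
  one_le := by nlinarith [hf.one_le, hg.one_le]
  nonneg := add_nonneg (mul_nonneg hf.nonneg (zero_le_one.trans hg.one_le))
    (mul_nonneg (zero_le_one.trans hf.one_le) hg.nonneg)
  an B hB := by
    have h : (fun B => (((f B * g B : 𝔸ˣ)) : 𝔸)) = fun B => (f B : 𝔸) * (g B : 𝔸) :=
      funext fun B => Units.val_mul _ _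
    rw [h]; exact (hf.an B hB).mul (hg.an B hB)
  an_inv B hB := by
    have h : (fun B => ((((f B * g B)⁻¹ : 𝔸ˣ)) : 𝔸)) = fun B => (((g B)⁻¹ : 𝔸ˣ) : 𝔸) * (((f B)⁻¹ : 𝔸ˣ) : 𝔸) :=
      funext fun B => by rw [mul_inv_rev, Units.val_mul]
    rw [h]; exact (hg.an_inv B hB).mul (hf.an_inv B hB)
  le B hB := by
    rw [Units.val_mul]
    exact (norm_mul_le _ _).trans (mul_le_mul (hf.le B hB) (hg.le B hB) (norm_nonneg _)
      (zero_le_one.trans hf.one_le))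
  le_inv B hB := by
    rw [mul_inv_rev, Units.val_mul, mul_comm K₁]
    exact (norm_mul_le _ _).trans (mul_le_mul (hg.le_inv B hB) (hf.le_inv B hB) (norm_nonneg _)
      (zero_le_one.trans hg.one_le))
  lip B hB := by
    have hK₁ : 0 ≤ K₁ := zero_le_one.trans hf.one_le
    have key : ((f B * g B : 𝔸ˣ) : 𝔸) - ((f 0 * g 0 : 𝔸ˣ) : 𝔸)
        = (((f B : 𝔸ˣ) : 𝔸) - (f 0 : 𝔸)) * (g B : 𝔸) + (f 0 : 𝔸) * (((g B : 𝔸ˣ) : 𝔸) - (g 0 : 𝔸)) := by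
      rw [Units.val_mul, Units.val_mul]; noncomm_ring
    rw [key]
    calc ‖(((f B : 𝔸ˣ) : 𝔸) - (f 0 : 𝔸)) * (g B : 𝔸) + (f 0 : 𝔸) * (((g B : 𝔸ˣ) : 𝔸) - (g 0 : 𝔸))‖
        ≤ ‖((f B : 𝔸ˣ) : 𝔸) - (f 0 : 𝔸)‖ * ‖(g B : 𝔸)‖ + ‖(f 0 : 𝔸)‖ * ‖((g B : 𝔸ˣ) : 𝔸) - (g 0 : 𝔸)‖ :=
          (norm_add_le _ _).trans (add_le_add (norm_mul_le _ _) (norm_mul_le _ _))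
      _ ≤ (κ₁ * ‖B‖) * K₂ + K₁ * (κ₂ * ‖B‖) :=
          add_le_add (mul_le_mul (hf.lip B hB) (hg.le B hB) (norm_nonneg _) (mul_nonneg hf.nonneg (norm_nonneg _)))
            (mul_le_mul hf.le_zero (hg.lip B hB) (norm_nonneg _) hK₁)
      _ = (κ₁ * K₂ + K₁ * κ₂) * ‖B‖ := by ring

/-- `pathProd` of `n` local words with common constants: `Kⁿ`, Lipschitz `n·Kⁿ·κ` (needs `‖1‖ = 1`). [folklore] -/
theorem pathProd [NormOneClass 𝔸] {G : E → ℕ → 𝔸ˣ} (hr : 0 < r) (hK : 1 ≤ K) (hκ : 0 ≤ κ)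
    (h : ∀ t, BallWord (fun B => G B t) r K κ) :
    ∀ n : ℕ, BallWord (fun B => B7Eq61Linearization.pathProd (G B) n) r (K ^ n) (n * K ^ n * κ)
  | 0 => by
    simp only [pathProd_zero, pow_zero, Nat.cast_zero, zero_mul]
    exact const hr le_rfl (by rw [Units.val_one, norm_one]) (by rw [inv_one, Units.val_one, norm_one])
  | n + 1 => by
    simp only [pathProd_succ]
    have hKn : (0 : ℝ) ≤ K ^ n := pow_nonneg (zero_le_one.trans hK) n
    refine ((pathProd hr hK hκ h n).mul (h n)).mono (le_of_eq (pow_succ K n).symm) ?_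
    have h1 : K ^ n * κ ≤ K ^ n * K * κ := by nlinarith [mul_nonneg hKn hκ]
    calc (n : ℝ) * K ^ n * κ * K + K ^ n * κ ≤ (n : ℝ) * K ^ n * κ * K + K ^ n * K * κ := by linarith
      _ = ((n + 1 : ℕ) : ℝ) * K ^ (n + 1) * κ := by rw [pow_succ]; push_cast; ring

/-- File 1's ENTIRE words restricted to a ball: an `ExpWord` of weight `w` is a local word on `ball 0 r` with `K = e^{wr}`
and Lipschitz constant `(e^{wr} + 1)∕r` (file 1's Schwarz bound `ExpWord.norm_sub_zero_le`). [folklore] -/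
theorem ofExpWord {w : ℝ} (hf : ExpWord f w) (hr : 0 < r) :
    BallWord f r (Real.exp (w * r)) ((Real.exp (w * r) + 1) / r) where
  r_pos := hr
  one_le := Real.one_le_exp (mul_nonneg hf.nonneg hr.le)
  nonneg := div_nonneg (by positivity) hr.le
  an B _ := hf.an B
  an_inv B _ := hf.an_inv B
  le B hB := (hf.le B).trans (Real.exp_le_exp.2 (mul_le_mul_of_nonneg_left hB.le hf.nonneg))
  le_inv B hB := (hf.le_inv B).trans (Real.exp_le_exp.2 (mul_le_mul_of_nonneg_left hB.le hf.nonneg))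
  lip B hB := hf.norm_sub_zero_le hB

end BallWord

/-! ## §2 The logarithm of a local word near `1` -/

section Log

variable {f : E → 𝔸ˣ} {r r' K κ ε : ℝ}

/-- On `‖B‖ < r′ ≤ r` with `‖f 0 − 1‖ ≤ ε` and `ε + κr′ ≤ 1∕2`: `‖f B − 1‖ ≤ 1∕2`. [folklore] -/
theorem BallWord.norm_sub_one_le_half (hf : BallWord f r K κ) (hle : r' ≤ r) (hε : ‖((f 0 : 𝔸ˣ) : 𝔸) - 1‖ ≤ ε)
    (hq : ε + κ * r' ≤ 1 / 2) {B : E} (hB : ‖B‖ < r') : ‖((f B : 𝔸ˣ) : 𝔸) - 1‖ ≤ 1 / 2 := by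
  have h1 := hf.lip B (hB.trans_le hle)
  calc ‖((f B : 𝔸ˣ) : 𝔸) - 1‖ = ‖(((f B : 𝔸ˣ) : 𝔸) - (f 0 : 𝔸)) + (((f 0 : 𝔸ˣ) : 𝔸) - 1)‖ := by rw [sub_add_sub_cancel]
    _ ≤ ‖((f B : 𝔸ˣ) : 𝔸) - (f 0 : 𝔸)‖ + ‖((f 0 : 𝔸ˣ) : 𝔸) - 1‖ := norm_add_le _ _
    _ ≤ κ * r' + ε := add_le_add (h1.trans (mul_le_mul_of_nonneg_left hB.le hf.nonneg)) hε
    _ ≤ 1 / 2 := by linarith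

/-- … so `B ↦ mlog (f B)` is analytic there. [folklore] -/
theorem BallWord.analyticAt_mlog [CompleteSpace 𝔸] (hf : BallWord f r K κ) (hle : r' ≤ r)
    (hε : ‖((f 0 : 𝔸ˣ) : 𝔸) - 1‖ ≤ ε) (hq : ε + κ * r' ≤ 1 / 2) {B : E} (hB : ‖B‖ < r') :
    AnalyticAt ℂ (fun B => mlog ((f B : 𝔸ˣ) : 𝔸)) B :=
  (MatrixLog.analyticAt_mlog ((hf.norm_sub_one_le_half hle hε hq hB).trans_lt (by norm_num))).comp_of_eq
    (hf.an B (hB.trans_le hle)) rfl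

/-- … with `‖mlog (f B)‖ ≤ 1`. [folklore] -/
theorem BallWord.norm_mlog_le_one [CompleteSpace 𝔸] (hf : BallWord f r K κ) (hle : r' ≤ r)
    (hε : ‖((f 0 : 𝔸ˣ) : 𝔸) - 1‖ ≤ ε) (hq : ε + κ * r' ≤ 1 / 2) {B : E} (hB : ‖B‖ < r') :
    ‖mlog ((f B : 𝔸ˣ) : 𝔸)‖ ≤ 1 := by
  have h := hf.norm_sub_one_le_half hle hε hq hB
  exact (norm_mlog_le_two_mul h).trans (by linarith)

end Log

/-! ## §3 The exponent of a family of local words -/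

section Exponent

variable [CompleteSpace 𝔸] {σ : Type*} {s : Finset σ} {a : σ → ℂ} {W : σ → E → 𝔸ˣ} {r r' K κ ε : ℝ}

/-- `S(B) = Σ_{x∈s} a_x • mlog (W_x B)` is analytic on `‖B‖ < r′`. [folklore] -/
theorem analyticAt_exponent (hW : ∀ x ∈ s, BallWord (W x) r K κ) (hle : r' ≤ r)
    (hε : ∀ x ∈ s, ‖((W x 0 : 𝔸ˣ) : 𝔸) - 1‖ ≤ ε) (hq : ε + κ * r' ≤ 1 / 2) {B : E} (hB : ‖B‖ < r') :
    AnalyticAt ℂ (fun B => ∑ x ∈ s, a x • mlog ((W x B : 𝔸ˣ) : 𝔸)) B :=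
  Finset.analyticAt_fun_sum s fun x hx => ((hW x hx).analyticAt_mlog hle (hε x hx) hq hB).fun_const_smul

/-- … and `‖S B‖ ≤ 1` when `Σ‖a_x‖ ≤ 1`. [folklore] -/
theorem norm_exponent_le (hW : ∀ x ∈ s, BallWord (W x) r K κ) (hle : r' ≤ r)
    (hε : ∀ x ∈ s, ‖((W x 0 : 𝔸ˣ) : 𝔸) - 1‖ ≤ ε) (hq : ε + κ * r' ≤ 1 / 2) (ha : ∑ x ∈ s, ‖a x‖ ≤ 1) {B : E}
    (hB : ‖B‖ < r') : ‖∑ x ∈ s, a x • mlog ((W x B : 𝔸ˣ) : 𝔸)‖ ≤ 1 :=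
  calc ‖∑ x ∈ s, a x • mlog ((W x B : 𝔸ˣ) : 𝔸)‖ ≤ ∑ x ∈ s, ‖a x • mlog ((W x B : 𝔸ˣ) : 𝔸)‖ := norm_sum_le _ _
    _ ≤ ∑ x ∈ s, ‖a x‖ * 1 := Finset.sum_le_sum fun x hx => by
        rw [norm_smul]
        exact mul_le_mul_of_nonneg_left ((hW x hx).norm_mlog_le_one hle (hε x hx) hq hB) (norm_nonneg _)
    _ ≤ 1 := by simpa using ha

end Exponent

/-! ## §4 The averaging step preserves local words -/

section Step

variable [CompleteSpace 𝔸] [NormOneClass 𝔸] {σ : Type*} {s : Finset σ} {a : σ → ℂ} {W : σ → E → 𝔸ˣ}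
  {T : E → 𝔸ˣ} {r r' K κ KT κT ε : ℝ}

/-- **THE AVERAGING STEP.**  If the loops `W_x` are local words on `ball 0 r` (common constants `K`, `κ`) with
`‖W_x(0) − 1‖ ≤ ε`, the weights satisfy `Σ‖a_x‖ ≤ 1`, the transporter `T` is a local word with constants `K_T`, `κ_T`,
and `ε + κr′ ≤ 1∕2`, `0 < r′ ≤ r`, then THE AVERAGE `G(B) := expU (Σ_x a_x • mlog W_x(B)) · T(B)` is a local word on
`ball 0 r′` with `K_G = 3K_T` and `κ_G = 6K_T∕r′` (`‖e^{±S}‖ ≤ e ≤ 3`; the Lipschitz constant by Schwarz-at-0). [folklore] -/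
theorem averagingStep_ballWord (hW : ∀ x ∈ s, BallWord (W x) r K κ) (hr' : 0 < r') (hle : r' ≤ r)
    (hε : ∀ x ∈ s, ‖((W x 0 : 𝔸ˣ) : 𝔸) - 1‖ ≤ ε) (hq : ε + κ * r' ≤ 1 / 2) (ha : ∑ x ∈ s, ‖a x‖ ≤ 1)
    (hT : BallWord T r KT κT) :
    BallWord (fun B => expU (∑ x ∈ s, a x • mlog ((W x B : 𝔸ˣ) : 𝔸)) * T B) r' (3 * KT) (6 * KT / r') := by
  have hKT : 1 ≤ KT := hT.one_le
  have hKT0 : 0 ≤ KT := zero_le_one.trans hKT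
  have hSan : ∀ B : E, ‖B‖ < r' → AnalyticAt ℂ (fun B => ∑ x ∈ s, a x • mlog ((W x B : 𝔸ˣ) : 𝔸)) B :=
    fun B hB => analyticAt_exponent hW hle hε hq hB
  have hS : ∀ B : E, ‖B‖ < r' → ‖∑ x ∈ s, a x • mlog ((W x B : 𝔸ˣ) : 𝔸)‖ ≤ 1 :=
    fun B hB => norm_exponent_le hW hle hε hq ha hB
  have hexpS : ∀ B : E, ‖B‖ < r' → ‖exp (∑ x ∈ s, a x • mlog ((W x B : 𝔸ˣ) : 𝔸))‖ ≤ 3 := fun B hB =>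
    ((norm_exp_le' _).trans (Real.exp_le_exp.2 (hS B hB))).trans (by have := Real.exp_one_lt_d9; linarith)
  have hexpS' : ∀ B : E, ‖B‖ < r' → ‖exp (-∑ x ∈ s, a x • mlog ((W x B : 𝔸ˣ) : 𝔸))‖ ≤ 3 := fun B hB =>
    ((norm_exp_le' _).trans (Real.exp_le_exp.2 ((norm_neg _).le.trans (hS B hB)))).trans (by have := Real.exp_one_lt_d9; linarith)
  have hval : (fun B => ((expU (∑ x ∈ s, a x • mlog ((W x B : 𝔸ˣ) : 𝔸)) * T B : 𝔸ˣ) : 𝔸))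
      = fun B => exp (∑ x ∈ s, a x • mlog ((W x B : 𝔸ˣ) : 𝔸)) * (T B : 𝔸) :=
    funext fun B => by rw [Units.val_mul, val_expU]
  have hinv : (fun B => (((expU (∑ x ∈ s, a x • mlog ((W x B : 𝔸ˣ) : 𝔸)) * T B)⁻¹ : 𝔸ˣ) : 𝔸))
      = fun B => (((T B)⁻¹ : 𝔸ˣ) : 𝔸) * exp (-∑ x ∈ s, a x • mlog ((W x B : 𝔸ˣ) : 𝔸)) :=
    funext fun B => by rw [mul_inv_rev, Units.val_mul, val_inv_expU]
  have hle' : ∀ B : E, ‖B‖ < r' →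
      ‖((expU (∑ x ∈ s, a x • mlog ((W x B : 𝔸ˣ) : 𝔸)) * T B : 𝔸ˣ) : 𝔸)‖ ≤ 3 * KT := fun B hB => by
    rw [Units.val_mul, val_expU]
    exact (norm_mul_le _ _).trans (mul_le_mul (hexpS B hB) (hT.le B (hB.trans_le hle)) (norm_nonneg _)
      (by norm_num))
  have han : ∀ B : E, ‖B‖ < r' →
      AnalyticAt ℂ (fun B => ((expU (∑ x ∈ s, a x • mlog ((W x B : 𝔸ˣ) : 𝔸)) * T B : 𝔸ˣ) : 𝔸)) B :=
    fun B hB => by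
      rw [hval]
      exact ((exp_analytic _).comp_of_eq (hSan B hB) rfl).mul (hT.an B (hB.trans_le hle))
  refine
    { r_pos := hr'
      one_le := by linarith
      nonneg := by positivity
      an := han
      an_inv := fun B hB => ?_
      le := hle'
      le_inv := fun B hB => ?_
      lip := fun B hB => ?_ }
  · rw [hinv]
    exact (hT.an_inv B (hB.trans_le hle)).mul ((exp_analytic _).comp_of_eq (hSan B hB).neg rfl)
  · rw [mul_inv_rev, Units.val_mul, val_inv_expU, mul_comm (3 : ℝ)]
    exact (norm_mul_le _ _).trans (mul_le_mul (hT.le_inv B (hB.trans_le hle)) (hexpS' B hB) (norm_nonneg _) hKT0)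
  · have h := norm_sub_apply_zero_le
      (f := fun B => ((expU (∑ x ∈ s, a x • mlog ((W x B : 𝔸ˣ) : 𝔸)) * T B : 𝔸ˣ) : 𝔸)) (R₀ := r') (K := 6 * KT)
      (fun z hz => (han z (mem_ball_zero_iff.1 hz)).differentiableWithinAt)
      (fun z hz => (norm_sub_le _ _).trans (by
        have h1 := hle' z (mem_ball_zero_iff.1 hz)
        have h0 := hle' 0 (by rw [norm_zero]; exact hr')
        linarith))
      (mem_ball_zero_iff.2 hB)
    simpa using h

end Step

/-! ## §5 The relative chart of a local word: analytic, `0` at `0`, linearly bounded -/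

section RelChart

variable {G : E → 𝔸ˣ} {r r'' K κ : ℝ}

omit [NormedSpace ℂ E] [NormedAlgebra ℂ 𝔸] in
/-- `G(0)·G(0)⁻¹ = 1`. [folklore] -/
theorem relQuot_zero (G : E → 𝔸ˣ) : (((G 0 * (G 0)⁻¹ : 𝔸ˣ)) : 𝔸) = 1 := by
  rw [mul_inv_cancel, Units.val_one]

/-- `B ↦ G(B)·G(0)⁻¹` is analytic on the ball. [folklore] -/
theorem analyticAt_relQuot (hG : BallWord G r K κ) {B : E} (hB : ‖B‖ < r) :
    AnalyticAt ℂ (fun B => (((G B * (G 0)⁻¹ : 𝔸ˣ)) : 𝔸)) B := by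
  have h : (fun B => (((G B * (G 0)⁻¹ : 𝔸ˣ)) : 𝔸)) = fun B => ((G B : 𝔸ˣ) : 𝔸) * (((G 0)⁻¹ : 𝔸ˣ) : 𝔸) :=
    funext fun B => Units.val_mul _ _
  rw [h]
  exact (hG.an B hB).mul analyticAt_const

/-- **NO SCHWARZ NEEDED**: `‖G(B)G(0)⁻¹ − 1‖ ≤ κK‖B‖` (`G(B)G(0)⁻¹ − 1 = (G(B) − G(0))·G(0)⁻¹`). [folklore] -/
theorem norm_relQuot_sub_one_le (hG : BallWord G r K κ) {B : E} (hB : ‖B‖ < r) :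
    ‖(((G B * (G 0)⁻¹ : 𝔸ˣ)) : 𝔸) - 1‖ ≤ κ * K * ‖B‖ := by
  have key : (((G B * (G 0)⁻¹ : 𝔸ˣ)) : 𝔸) - 1 = (((G B : 𝔸ˣ) : 𝔸) - ((G 0 : 𝔸ˣ) : 𝔸)) * (((G 0)⁻¹ : 𝔸ˣ) : 𝔸) := by
    rw [sub_mul, Units.val_mul, Units.mul_inv]
  rw [key]
  calc ‖(((G B : 𝔸ˣ) : 𝔸) - ((G 0 : 𝔸ˣ) : 𝔸)) * (((G 0)⁻¹ : 𝔸ˣ) : 𝔸)‖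
      ≤ ‖((G B : 𝔸ˣ) : 𝔸) - ((G 0 : 𝔸ˣ) : 𝔸)‖ * ‖(((G 0)⁻¹ : 𝔸ˣ) : 𝔸)‖ := norm_mul_le _ _
    _ ≤ (κ * ‖B‖) * K := mul_le_mul (hG.lip B hB) hG.le_inv_zero (norm_nonneg _) (mul_nonneg hG.nonneg (norm_nonneg _))
    _ = κ * K * ‖B‖ := by ring

/-- On `‖B‖ < r″ ≤ r` with `κKr″ ≤ 1∕2`: `‖G(B)G(0)⁻¹ − 1‖ ≤ 1∕2`. [folklore] -/
theorem norm_relQuot_sub_one_le_half (hG : BallWord G r K κ) (hle : r'' ≤ r) (hK : κ * K * r'' ≤ 1 / 2) {B : E}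
    (hB : ‖B‖ < r'') : ‖(((G B * (G 0)⁻¹ : 𝔸ˣ)) : 𝔸) - 1‖ ≤ 1 / 2 := by
  have hC : 0 ≤ κ * K := mul_nonneg hG.nonneg (zero_le_one.trans hG.one_le)
  exact (norm_relQuot_sub_one_le hG (hB.trans_le hle)).trans ((mul_le_mul_of_nonneg_left hB.le hC).trans hK)

variable [CompleteSpace 𝔸]

/-- **THE RELATIVE CHART OF A LOCAL WORD IS ANALYTIC**: `B ↦ (−i)·log(G(B)G(0)⁻¹)` on `ball 0 r″`. [folklore] -/
theorem relChart_analyticOnNhd (hG : BallWord G r K κ) (hle : r'' ≤ r) (hK : κ * K * r'' ≤ 1 / 2) :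
    AnalyticOnNhd ℂ (fun B => (-Complex.I) • mlog (((G B * (G 0)⁻¹ : 𝔸ˣ)) : 𝔸)) (ball 0 r'') := fun B hB => by
  have hB' : ‖B‖ < r'' := mem_ball_zero_iff.1 hB
  have hlt : ‖(((G B * (G 0)⁻¹ : 𝔸ˣ)) : 𝔸) - 1‖ < 1 :=
    (norm_relQuot_sub_one_le_half hG hle hK hB').trans_lt (by norm_num)
  exact ((MatrixLog.analyticAt_mlog hlt).comp_of_eq (analyticAt_relQuot hG (hB'.trans_le hle)) rfl).fun_const_smul

omit [NormedSpace ℂ E] [CompleteSpace 𝔸] in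
/-- **… VANISHES AT `0`**. [folklore] -/
theorem relChart_zero (G : E → 𝔸ˣ) : (-Complex.I) • mlog (((G 0 * (G 0)⁻¹ : 𝔸ˣ)) : 𝔸) = 0 := by
  rw [relQuot_zero, mlog_one, smul_zero]

/-- **… AND IS LINEARLY BOUNDED**: `‖(−i)·log(G(B)G(0)⁻¹)‖ ≤ 2κK‖B‖ (≤ 1)` on `ball 0 r″`. [folklore] -/
theorem norm_relChart_le (hG : BallWord G r K κ) (hle : r'' ≤ r) (hK : κ * K * r'' ≤ 1 / 2) {B : E}
    (hB : ‖B‖ < r'') : ‖(-Complex.I) • mlog (((G B * (G 0)⁻¹ : 𝔸ˣ)) : 𝔸)‖ ≤ 2 * (κ * K) * ‖B‖ := by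
  rw [norm_smul, norm_neg, Complex.norm_I, one_mul]
  have h1 := norm_mlog_le_two_mul (norm_relQuot_sub_one_le_half hG hle hK hB)
  have h2 := norm_relQuot_sub_one_le hG (hB.trans_le hle)
  calc ‖mlog (((G B * (G 0)⁻¹ : 𝔸ˣ)) : 𝔸)‖ ≤ 2 * ‖(((G B * (G 0)⁻¹ : 𝔸ˣ)) : 𝔸) - 1‖ := h1
    _ ≤ 2 * (κ * K * ‖B‖) := mul_le_mul_of_nonneg_left h2 zero_le_two
    _ = 2 * (κ * K) * ‖B‖ := by ring

end RelChart

end Summit.QuantumFields.BalabanUV.T4Continuum.ShellMeasureAverageAnalyticLoc
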